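import Summits.RiemannHypothesis.RiemannHypothesis.Theorems.IntegerScrewCensusFloor48
import Summits.RiemannHypothesis.RiemannHypothesis.Theorems.IntegerScrewCensusFloor56
import Summits.RiemannHypothesis.RiemannHypothesis.Theorems.IntegerScrewCensusFloor64
import Summits.RiemannHypothesis.RiemannHypothesis.Theorems.IntegerScrewCensusFloor80
import Summits.RiemannHypothesis.RiemannHypothesis.Theorems.IntegerScrewCensusFloor96
import Summits.RiemannHypothesis.RiemannHypothesis.Theorems.IntegerScrewCensusFloor112

/-!
# Route `IntegerScrew` — the six census brackets `T_DD(M) ∈ (lo, hi]`, `M = 48, 56, 64, 80, 96, 112`, PROVED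

`CensusBracketsRefPassed` (`Theorems/ScrewManifestCertDefs.lean`, item of route No.9 `IntegerScrew`):
`Rung 47 170 175 ∧ Rung 55 200 205 ∧ Rung 63 235 240 ∧ Rung 79 305 310 ∧ Rung 95 375 380 ∧ Rung 111 440 445` with
`Rung n lo hi := ¬ ManifestCert n (1/10) lo ∧ ManifestCert n (1/10) hi`.  The `hi` halves are the kernel-checked census
manifest certificates (`IntegerScrewCensusCeilings`: fast checker `fastCheckB` + soundness `manifestCert_of_fastCheckB`);
the `lo` halves are the kernel-checked census DUAL certificates (`IntegerScrewCensusFloor{48,…,112}`: dual checker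
`dualLight`/`dualCheckW` + soundness `not_manifestCert_of_check`, `IntegerScrewCensusDualSound`, resting on
`Manifest.dualCert_sound`).  Everything is `decide +kernel` plus real analysis; axioms standard.
RH-FREE finite statements about Suzuki's screw matrices `S_M`; nothing here bears on the truth of RH.
-/

set_option linter.dupNamespace false
set_option autoImplicit false

namespace Summit.RiemannHypothesis.RiemannHypothesis.Theorems.IntegerScrew.Manifest

/-- **`T_DD(48) ∈ (170, 175]`.** -/
theorem censusRung_48 : Rung 47 170 175 := ⟨Fast.censusFloor_48, manifestCert_48_175⟩

/-- **`T_DD(56) ∈ (200, 205]`.** -/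
theorem censusRung_56 : Rung 55 200 205 := ⟨Fast.censusFloor_56, manifestCert_56_205⟩

/-- **`T_DD(64) ∈ (235, 240]`.** -/
theorem censusRung_64 : Rung 63 235 240 := ⟨Fast.censusFloor_64, manifestCert_64_240⟩

/-- **`T_DD(80) ∈ (305, 310]`.** -/
theorem censusRung_80 : Rung 79 305 310 := ⟨Fast.censusFloor_80, manifestCert_80_310⟩

/-- **`T_DD(96) ∈ (375, 380]`.** -/
theorem censusRung_96 : Rung 95 375 380 := ⟨Fast.censusFloor_96, manifestCert_96_380⟩

/-- **`T_DD(112) ∈ (440, 445]`.** -/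
theorem censusRung_112 : Rung 111 440 445 := ⟨Fast.censusFloor_112, manifestCert_112_445⟩

/-- **THE SIX REF-PASSED CENSUS BRACKETS, PROVED** (closes the item `CensusBracketsRefPassed`). -/
theorem censusBracketsRefPassed : CensusBracketsRefPassed :=
  ⟨censusRung_48, censusRung_56, censusRung_64, censusRung_80, censusRung_96, censusRung_112⟩

/-- The historical "provisional" pair `T_DD(56) ∈ (200,205]`, `T_DD(64) ∈ (235,240]`, proved as well. -/
theorem censusBracketsProvisional : CensusBracketsProvisional := ⟨censusRung_56, censusRung_64⟩

end Summit.RiemannHypothesis.RiemannHypothesis.Theorems.IntegerScrew.Manifest
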